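import Summits.ResolutionOfSingularities.ResolutionOfSingularities.Theorems.WildConesCampaignW46HypersurfacesCharTwoEmbDimStates

/-!
# [OURS · L1 W4.6, rung (ii) at p = 2, EVERY dimension n] THE HYPERBOLIC-SPLITTING REGIME `e ≤ 1` IS
# CLOSED under the point-blow-up dynamics with the exact drop `μ' + 2 = μ`; the TRICHOTOMY by embedding
# dimension; `e = 0` is resolved by one blow-up; a smooth point within `μ/2` blow-ups along every branch
# — hypersurface double points `z² = a(u₁,…,uₙ)` over every field of characteristic 2

HONEST FRAMING. Everything here is OURS: theorems about route WildCones' own TYPED point-blow-up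
dynamics (`Theorems/WildConesClassicalRegimesDefs.lean`: a state is the coefficient function `c` of
`a = Σ c(A) u^A`, the atom is `z² = a(u₁,…,uₙ)`; `step` = blow up the closed point, chart `u_i`, divide by
`u_i²`, translate by `τ`, delete square monomials; `MultP` = cleaned order `≥ 2` (a double point), `OrdP`
= a cleaned monomial of degree `2` (a hyperbolic pair `u_j u_l`), `Isol` = finite Milnor algebra
`κ⟦u⟧/(∂a)`, `mu` = its dimension) and the two numbers of
`Theorems/WildConesCampaignW46HypersurfacesCharTwoEmbDimDefs.lean` (p498937): `jetTwoColength f =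
dim_κ κ⟦X⟧/((∂f) + 𝔪²)` and `milnorEmbDim p n κ c = jetTwoColength (ser c) - 1 =` the EMBEDDING DIMENSION
`e(c)` of the Milnor algebra (for a double point in characteristic `2`: the corank of the polar form of
the cleaned quadratic part). NOTHING here is a statement of the manuscript [Hironaka2017] and nothing of
it is used; no FACT-LIST premise is used (the hyperbolic-pair splitting of Greuel–Pfister is a kernel
theorem of the tree, `WildCones.MuDropCharTwoOrdP.pair_reduction` / `descent` / `descent_step`). AI
review is weaker than expert review. Cell res-hironaka (LADDER-RESOLUTION rung L, D-0089), slot W4.6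
«restricted regimes as rungs», seat res-L1-s46-pv-4 (gen 3): «(ii) THREEFOLD HYPERSURFACES, second
prover: the p = 2 hyperbolic-splitting regime of `ClassicalRegimes` (n ≥ 3, order-2 cleaned states)».
Host: route `WildCones`, crux `ClassicalRegimes` (stmt-ResolutionOfSingularities-16884; proved).
Third of three files (`…EmbDim`, `…EmbDimStates`, this). Together they REPLACE THE ROLE of Th. 16.6 (2)
Eq. (127) (H. Hironaka, ms. 2017-03-23, p.84 l.10–20) and of the resolution conclusion of Th. 16.13
(p.87 l.26–30) in ONE regime — isolated double points with curvilinear Milnor algebra, of hypersurfaces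
of ANY dimension in characteristic `2` — with OUR invariant, the Milnor number; NOT a statement of the
manuscript.

WHAT IS NEW (every `n`, every field of characteristic `2`; gen 2 had `n = 3` only, where `e ≤ 1 ↔ OrdP`):

* `formal_trichotomy` — for the blow-up relation `X_i² G = a∘Φ_{i,τ}` (`ord a ≥ 2`, `G` without linear
  terms): embedding dimension `≤ 1` and `a` isolated ⇒ `G` isolated, `dim` drops by EXACTLY two,
  embedding dimension unchanged; embedding dimension `≥ 3` ⇒ `G` NOT isolated. Strong induction on `n`
  along the tree's `descent_step`, with `jetTwoColength_eq_of_equiv`; leaves `n = 1` (curve leaf),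
  `n = 2` (vacuous), `n ≥ 3` (`caseA_not_finite`).
* `hypersurface_regime_step` — CLOSURE OF THE REGIME `MultP ∧ Isol ∧ e ≤ 1` with `μ' + 2 = μ` and `e' = e`;
  `hypersurface_not_isol_step_of_three_le` — `e ≥ 3`: every double successor is NON-isolated;
  `hypersurface_trichotomy` — both; `e = 2` is not decided by `e` (p485483: `n = 4`, `e = 2`, non-isolated
  double successor; for surfaces, `z² = u₀³ + u₁³` has `e = 2` and the isolated double successor
  `u₀(u₁ + u₁² + u₁³)` in chart `u₀` at `τ = 1` — stated here as orientation, not proved in this file).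
* `hypersurface_not_multP_step_of_milnorEmbDim_eq_zero` / `…_of_mu_eq_one` — `e = 0` (`μ = 1`,
  non-degenerate polar form, `n` even): NO double point among the successors — resolved by one blow-up
  in every chart at every point; `hypersurface_four_le_mu_of_double_successor` — a double successor forces
  `e = 1`, `n` odd, `μ ≥ 4`.
* `hypersurface_regime_run`, `hypersurface_two_mul_add_two_le_mu`, `hypersurface_smooth_le_half` — along
  ANY chart word and translation word: the regime persists with `μ(c_m) + 2m = μ(c₀)` while the states are
  double points, `2M + 2 ≤ μ(c₀)` for `M ≥ 1` consecutive double successors, and a SMOOTH point (a linear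
  cleaned monomial, never the zero state) is reached at an index `m ≤ (μ(c₀)+1)/2`.

VACUITY. The hypotheses `MultP ∧ Isol ∧ e ≤ 1 ∧ MultP (step …)` are simultaneously satisfiable: in the
kernel for `n = 3` by p470498 (`z² = u₀u₁ + u₂^(2j+1)`, `μ = 2j`, successor in chart `u₂` at `τ = 0` again a
double point for `j ≥ 2`; `e = 1` there by `threefold_milnorEmbDim_eq`); `e = 0` is inhabited by every
isolated double state with `μ = 1` (`milnorEmbDim_eq_zero_iff`). The conclusions are not implied by
bookkeeping: closure of isolatedness FAILS at `e = 2` and `e = 3` (p485483, p484275).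

References: G.-M. Greuel, G. Pfister, The splitting lemma in any characteristic, J. Algebra 689 (2026)
= arXiv:2507.17078, Thm 3.5 / Cor 3.7 [GreuelPfister2026] (through the tree's `pair_reduction`,
`descent`, `descent_step`); H. Hironaka, ms. 2017-03-23 [Hironaka2017], Th. 16.6 p.84, Th. 16.13 p.87 —
quoted for the ROLE replaced only, under adjudication, not cited as fact.
-/

noncomputable section

-- single-problem summit: the doubled namespace component `ResolutionOfSingularities` is forced
set_option linter.dupNamespace false

open scoped BigOperators Classical

open MvPowerSeries IsLocalRing

open Literature.AlgebraicGeometry.Resolution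

namespace Summit.ResolutionOfSingularities.ResolutionOfSingularities.Theorems

namespace CampaignW46.HypersurfacesCharTwo

open WildCones WildCones.MuDropCharTwoOrdP ThreefoldsCharTwo

variable {κ : Type} [Field κ]

/-! ## The blow-up step: the formal trichotomy by embedding dimension -/

/-- [OURS · L1 W4.6] **THE FORMAL TRICHOTOMY** (characteristic two, every `n`). Let `X_i² G = a∘Φ_{i,τ}`
be the blow-up relation (`ord a ≥ 2`, `G` without linear terms — the successor is again a double
point). (1) If `jetTwoColength a ≤ 2` (embedding dimension `≤ 1`) and the Milnor algebra of `a` is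
finite, then the Milnor algebra of `G` is FINITE, of dimension smaller by EXACTLY two, and
`jetTwoColength G = jetTwoColength a`. (2) If `jetTwoColength a ≥ 4` (embedding dimension `≥ 3`), the
Milnor algebra of `G` is NOT finite. (Embedding dimension `2` is left open: both happen.) Strong
induction on `n` along the tree's `descent_step` (a hyperbolic pair away from the chart index,
`exists_pair_ne`), with the invariance `jetTwoColength_eq_of_equiv`; leaves: `n = 1` the curve leaf
(`curve_finite_strict`, `JacobianBudget.CharTwo.curve_drop_eq`, `jetTwoColength_one`), `n = 2` vacuous,
`n ≥ 3` Case A (`caseA_not_finite`). [cite: GreuelPfister2026, Thm 3.5 and Cor 3.7] -/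
theorem formal_trichotomy [CharP κ 2] : ∀ (n : ℕ) (i : Fin n) (τ : Fin n → κ)
    (a G : MvPowerSeries (Fin n) κ), 2 ≤ a.order → (∀ s, coeff (Finsupp.single s 1) G = 0) →
    X i ^ 2 * G = subst (fun s => if s = i then (X i : MvPowerSeries (Fin n) κ)
      else X i * (X s + C (τ s))) a →
    (jetTwoColength a ≤ 2 →
      Module.Finite κ (MvPowerSeries (Fin n) κ ⧸
        Ideal.span (Set.range fun s => MvPowerSeries.pderiv s a)) →
      Module.Finite κ (MvPowerSeries (Fin n) κ ⧸
          Ideal.span (Set.range fun s => MvPowerSeries.pderiv s G)) ∧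
        Module.finrank κ (MvPowerSeries (Fin n) κ ⧸
            Ideal.span (Set.range fun s => MvPowerSeries.pderiv s G)) + 2 =
          Module.finrank κ (MvPowerSeries (Fin n) κ ⧸
            Ideal.span (Set.range fun s => MvPowerSeries.pderiv s a)) ∧
        jetTwoColength G = jetTwoColength a) ∧
    (4 ≤ jetTwoColength a →
      ¬ Module.Finite κ (MvPowerSeries (Fin n) κ ⧸
        Ideal.span (Set.range fun s => MvPowerSeries.pderiv s G))) := by
  intro n
  induction n using Nat.strong_induction_on with
  | _ n ih =>
  intro i τ a G ha hG0 hG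
  by_cases hpair : ∃ j l : Fin n, j ≠ l ∧ coeff (Finsupp.single j 1 + Finsupp.single l 1) a ≠ 0
  · obtain ⟨j, l, hjl, hj, hl, hq⟩ := exists_pair_ne i τ ha hG hG0 hpair
    obtain ⟨e, i', he, hi', -⟩ := exists_compl_embedding hjl (Ne.symm hj) (Ne.symm hl)
    obtain ⟨a', G', ha', hG0', hG', ⟨εa⟩, ⟨εG⟩⟩ :=
      descent_step i τ ha hG0 hG hjl hj hl hq e he i' hi'
    have hlt : n - 2 < n := by
      have := Fin.pos i
      omega
    have hca : jetTwoColength a = jetTwoColength a' := jetTwoColength_eq_of_equiv εa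
    have hcG : jetTwoColength G = jetTwoColength G' := jetTwoColength_eq_of_equiv εG
    obtain ⟨h1, h2⟩ := ih (n - 2) hlt i' (fun t => τ (e t)) a' G' ha' hG0' hG'
    refine ⟨fun hle hfa => ?_, fun hge hfG => ?_⟩
    · haveI := hfa
      obtain ⟨hfG', hdrop, hcol⟩ :=
        h1 (by rw [← hca]; exact hle) (Module.Finite.equiv εa.toLinearEquiv)
      haveI := hfG'
      refine ⟨Module.Finite.equiv εG.symm.toLinearEquiv, ?_, ?_⟩
      · rw [εa.toLinearEquiv.finrank_eq, εG.toLinearEquiv.finrank_eq]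
        exact hdrop
      · rw [hca, hcG]
        exact hcol
    · haveI := hfG
      exact h2 (by rw [← hca]; exact hge) (Module.Finite.equiv εG.toLinearEquiv)
  · push Not at hpair
    have ha' := (FormalCoordChange.two_le_order_iff a).mp ha
    have hcol : jetTwoColength a = n + 1 := jetTwoColength_of_no_pair ha'.2 hpair
    rcases n with _ | _ | _ | n
    · exact i.elim0
    · refine ⟨fun _ hfa => ?_, fun h4 => by omega⟩
      have hfG := curve_finite_strict i τ hG hfa
      refine ⟨hfG, JacobianBudget.CharTwo.curve_drop_eq i τ hG hfG, ?_⟩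
      rw [hcol, jetTwoColength_one (hG0 0)]
    · exact ⟨fun h _ => by omega, fun h => by omega⟩
    · exact ⟨fun h _ => by omega, fun _ => caseA_not_finite (by omega) i τ ha hG hG0 hpair⟩

/-! ## States: the hyperbolic-splitting regime `e ≤ 1` in every dimension -/

section Dynamics

variable {n : ℕ}

/-- [OURS · L1 W4.6] Cleaning does not change the Jacobian ideal: the colength of the 2-jet of the
gradient ideal of the successor STATE equals that of the formal strict transform `G` of the
dictionary `dictCharTwo`. [folklore] -/
theorem jetTwoColength_ser_eq_of_jac_eq {p : ℕ} {c : (Fin n → ℕ) → κ} {G : MvPowerSeries (Fin n) κ}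
    (h : jac p n κ c = Ideal.span (Set.range fun s => MvPowerSeries.pderiv s G)) :
    jetTwoColength (ser p n κ c) = jetTwoColength G := by
  unfold jetTwoColength
  rw [← jac_eq_span_pderiv, h]

/-- [OURS · L1 W4.6 rung (ii) at `p = 2`, every dimension; NOT a statement of the manuscript]
**CLOSURE OF THE HYPERBOLIC-SPLITTING REGIME `e ≤ 1`, WITH THE EXACT DROP** (hypersurface double
points `z² = a(u₁,…,uₙ)`, any field of characteristic `2`, any `n`): if a state is an ISOLATED double
point whose Milnor algebra has embedding dimension `e(c) ≤ 1` (polar form of corank `≤ 1`) and its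
point-blow-up successor (chart `i`, translation `τ`) is again a double point, then the successor is
ISOLATED, its Milnor number is SMALLER BY EXACTLY TWO, and its embedding dimension is the same. For
`n = 3` this is gen 2's `threefold_regime_step` (`e ≤ 1 ↔ OrdP`,
`threefold_milnorEmbDim_le_one_iff_ordP`); for `n ≥ 4` it is the correct replacement of the
order-2-cleaned regime, which is NOT closed (p485483, p484275: those examples have `e = 2`, `e = 3`).
[cite: GreuelPfister2026, Thm 3.5 and Cor 3.7] -/
theorem hypersurface_regime_step [CharP κ 2] (c : (Fin n → ℕ) → κ) (i : Fin n) (τ : Fin n → κ)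
    (hM : MultP 2 n κ c) (hI : Isol 2 n κ c) (he : milnorEmbDim 2 n κ c ≤ 1)
    (hM' : MultP 2 n κ (step 2 n κ i τ c)) :
    Isol 2 n κ (step 2 n κ i τ c) ∧ mu 2 n κ (step 2 n κ i τ c) + 2 = mu 2 n κ c ∧
      milnorEmbDim 2 n κ (step 2 n κ i τ c) = milnorEmbDim 2 n κ c := by
  obtain ⟨G, ha, hG0, hG, hj, hj'⟩ := dictCharTwo c i τ hM hM'
  have hcol := (milnorEmbDim_le_and_mod_two hM).2.2
  obtain ⟨h1, -⟩ := formal_trichotomy n i τ (ser 2 n κ c) G ha hG0 hG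
  obtain ⟨hfG, hdrop, hcolG⟩ := h1 (by omega) ((isol_iff_finite_pderiv c).mp hI)
  refine ⟨?_, ?_, ?_⟩
  · change Module.Finite κ (MvPowerSeries (Fin n) κ ⧸ jac 2 n κ (step 2 n κ i τ c))
    rw [hj']
    exact hfG
  · change Module.finrank κ (MvPowerSeries (Fin n) κ ⧸ jac 2 n κ (step 2 n κ i τ c)) + 2 =
      Module.finrank κ (MvPowerSeries (Fin n) κ ⧸ jac 2 n κ c)
    rw [hj, hj']
    exact hdrop
  · unfold milnorEmbDim
    rw [jetTwoColength_ser_eq_of_jac_eq hj', hcolG]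

/-- [OURS · L1 W4.6 rung (ii) at `p = 2`, every dimension; NOT a statement of the manuscript]
**EMBEDDING DIMENSION `≥ 3`: the successor double point is NEVER isolated** (any field of
characteristic `2`, any `n`): if a double state has `e(c) ≥ 3` (polar form of corank `≥ 3`; for
`n = 3`: cleaned order `≥ 3`) and its point-blow-up successor is a double point, the successor is NOT
an isolated singularity — such states leave the forced regime only through non-isolated double points.
The state's own isolatedness is not needed. (`n = 3`: gen 2's `threefold_not_isol_step_of_not_ordP`.)
[folklore] -/
theorem hypersurface_not_isol_step_of_three_le [CharP κ 2] (c : (Fin n → ℕ) → κ) (i : Fin n)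
    (τ : Fin n → κ) (hM : MultP 2 n κ c) (he : 3 ≤ milnorEmbDim 2 n κ c)
    (hM' : MultP 2 n κ (step 2 n κ i τ c)) : ¬ Isol 2 n κ (step 2 n κ i τ c) := by
  obtain ⟨G, ha, hG0, hG, -, hj'⟩ := dictCharTwo c i τ hM hM'
  have hcol := (milnorEmbDim_le_and_mod_two hM).2.2
  obtain ⟨-, h2⟩ := formal_trichotomy n i τ (ser 2 n κ c) G ha hG0 hG
  change ¬ Module.Finite κ (MvPowerSeries (Fin n) κ ⧸ jac 2 n κ (step 2 n κ i τ c))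
  rw [hj']
  exact h2 (by omega)

/-- [OURS · L1 W4.6 rung (ii) at `p = 2`, every dimension; NOT a statement of the manuscript] **THE
TRICHOTOMY** for an isolated double state of `z² = a(u₁,…,uₙ)` whose point-blow-up successor is a
double point (any field of characteristic `2`): `e(c) ≤ 1 ⇒` successor isolated; `e(c) ≥ 3 ⇒`
successor not isolated; only `e(c) = 2` is undecided by `e` (and genuinely mixed: for `n = 2`,
`z² = u₀³ + u₁³` over `𝔽₂` has the isolated double successor `u₀(u₁ + u₁² + u₁³)` in chart `u₀` at
`τ = 1`, while for `n = 4`, `z² = u₀u₁ + u₂⁵ + u₃⁵` has a non-isolated one, p485483). Since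
`e ≡ n (mod 2)` and `e ≤ n`, for `n = 3` the value `e = 2` does not occur and the trichotomy is gen 2's
DICHOTOMY `threefold_isol_step_iff_ordP`. [folklore] -/
theorem hypersurface_trichotomy [CharP κ 2] (c : (Fin n → ℕ) → κ) (i : Fin n) (τ : Fin n → κ)
    (hM : MultP 2 n κ c) (hI : Isol 2 n κ c) (hM' : MultP 2 n κ (step 2 n κ i τ c)) :
    (milnorEmbDim 2 n κ c ≤ 1 → Isol 2 n κ (step 2 n κ i τ c)) ∧
      (3 ≤ milnorEmbDim 2 n κ c → ¬ Isol 2 n κ (step 2 n κ i τ c)) :=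
  ⟨fun he => (hypersurface_regime_step c i τ hM hI he hM').1,
    fun he => hypersurface_not_isol_step_of_three_le c i τ hM he hM'⟩

/-- [OURS · L1 W4.6 rung (ii) at `p = 2`, every dimension; NOT a statement of the manuscript]
**EMBEDDING DIMENSION ZERO: RESOLVED BY ONE BLOW-UP** (any field of characteristic `2`, any — necessarily
even — `n`): a double state with NON-DEGENERATE polar form (`e(c) = 0`, equivalently `μ = 1`,
`milnorEmbDim_eq_zero_iff`) has NO double point among its point-blow-up successors: every chart and
every translation give multiplicity `< 2`. (A double successor would be isolated with `μ + 2 = 1`.)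
[folklore] -/
theorem hypersurface_not_multP_step_of_milnorEmbDim_eq_zero [CharP κ 2] (c : (Fin n → ℕ) → κ)
    (hM : MultP 2 n κ c) (he : milnorEmbDim 2 n κ c = 0) (i : Fin n) (τ : Fin n → κ) :
    ¬ MultP 2 n κ (step 2 n κ i τ c) := by
  intro hM'
  obtain ⟨hI, hμ⟩ := (milnorEmbDim_eq_zero_iff hM).mp he
  have h := (hypersurface_regime_step c i τ hM hI (by omega) hM').2.1
  omega

/-- [OURS · L1 W4.6; NOT a statement of the manuscript] **Milnor number one: resolved by one blow-up**
(every `n`, characteristic `2`): an isolated double state with `μ = 1` has no double successor.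
[folklore] -/
theorem hypersurface_not_multP_step_of_mu_eq_one [CharP κ 2] (c : (Fin n → ℕ) → κ)
    (hM : MultP 2 n κ c) (hI : Isol 2 n κ c) (hμ : mu 2 n κ c = 1) (i : Fin n) (τ : Fin n → κ) :
    ¬ MultP 2 n κ (step 2 n κ i τ c) :=
  hypersurface_not_multP_step_of_milnorEmbDim_eq_zero c hM
    ((milnorEmbDim_eq_zero_iff hM).mpr ⟨hI, hμ⟩) i τ

/-- [OURS · L1 W4.6; NOT a statement of the manuscript] In the regime `e ≤ 1` a state with a double
successor has `e = 1` (so `n` is odd) and `μ ≥ 4`: `μ` is even and drops by two to a positive even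
number. (`n = 3`: gen 2's `threefold_four_le_mu_of_double_successor`.) [folklore] -/
theorem hypersurface_four_le_mu_of_double_successor [CharP κ 2] (c : (Fin n → ℕ) → κ) (i : Fin n)
    (τ : Fin n → κ) (hM : MultP 2 n κ c) (hI : Isol 2 n κ c) (he : milnorEmbDim 2 n κ c ≤ 1)
    (hM' : MultP 2 n κ (step 2 n κ i τ c)) :
    milnorEmbDim 2 n κ c = 1 ∧ n % 2 = 1 ∧ 4 ≤ mu 2 n κ c := by
  have he1 : milnorEmbDim 2 n κ c = 1 := by
    rcases Nat.lt_or_ge (milnorEmbDim 2 n κ c) 1 with h0 | h1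
    · exact absurd hM' (hypersurface_not_multP_step_of_milnorEmbDim_eq_zero c hM (by omega) i τ)
    · omega
  obtain ⟨hI', hdrop, he'⟩ := hypersurface_regime_step c i τ hM hI he hM'
  have hpar := (milnorEmbDim_le_and_mod_two hM).2.1
  obtain ⟨-, h2', -⟩ := curvilinear_of_milnorEmbDim_eq_one hM' hI' (by rw [he', he1])
  exact ⟨he1, by omega, by omega⟩

/-! ## Along runs: the regime persists while the states are double points, and resolves within `μ/2` -/

/-- [OURS · L1 W4.6 rung (ii) at `p = 2`, every dimension; NOT a statement of the manuscript] **ALONG A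
RUN the regime `e ≤ 1` persists with the exact budget**: from an isolated double state `c₀` with
`e(c₀) ≤ 1`, along any chart word `i` and translation word `t`, if the states `c_0,…,c_M` are all double
points then every `c_m` (`m ≤ M`) is isolated with `e(c_m) = e(c₀)` and `μ(c_m) + 2m = μ(c₀)`.
[folklore] -/
theorem hypersurface_regime_run [CharP κ 2] (c₀ : (Fin n → ℕ) → κ) (i : ℕ → Fin n)
    (t : ℕ → Fin n → κ) (hI₀ : Isol 2 n κ c₀) (he₀ : milnorEmbDim 2 n κ c₀ ≤ 1)
    {M : ℕ} (hrun : ∀ m ≤ M, MultP 2 n κ (run 2 n κ c₀ i t m)) :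
    ∀ m ≤ M, Isol 2 n κ (run 2 n κ c₀ i t m) ∧
      milnorEmbDim 2 n κ (run 2 n κ c₀ i t m) = milnorEmbDim 2 n κ c₀ ∧
      mu 2 n κ (run 2 n κ c₀ i t m) + 2 * m = mu 2 n κ c₀ := by
  intro m
  induction m with
  | zero => intro _; exact ⟨hI₀, rfl, by simp [run]⟩
  | succ m ih =>
    intro hm
    obtain ⟨hI, he, hμ⟩ := ih (by omega)
    have hstep := hypersurface_regime_step (run 2 n κ c₀ i t m) (i m) (t m) (hrun m (by omega)) hI
      (by rw [he]; exact he₀) (hrun (m + 1) hm)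
    refine ⟨hstep.1, hstep.2.2.trans he, ?_⟩
    change mu 2 n κ (step 2 n κ (i m) (t m) (run 2 n κ c₀ i t m)) + 2 * (m + 1) = mu 2 n κ c₀
    omega

/-- [OURS · L1 W4.6 rung (ii) at `p = 2`, every dimension; NOT a statement of the manuscript]
**RESOLUTION WITHIN `μ/2` BLOW-UPS ALONG EVERY BRANCH**: from an isolated double state `c₀` with
`e(c₀) ≤ 1`, along ANY chart word and ANY translation word, the states `c_0, …, c_M` cannot all be double
points once `2M + 2 > μ(c₀)`: the number of consecutive double points met from `c₀` is at most `μ(c₀)/2`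
(for `e = 0`: `μ = 1`, none after `c₀`). (`n = 3`: gen 2's `threefold_two_mul_add_two_le_mu`.) [folklore] -/
theorem hypersurface_two_mul_add_two_le_mu [CharP κ 2] (c₀ : (Fin n → ℕ) → κ) (i : ℕ → Fin n)
    (t : ℕ → Fin n → κ) (hI₀ : Isol 2 n κ c₀) (he₀ : milnorEmbDim 2 n κ c₀ ≤ 1)
    {M : ℕ} (hrun : ∀ m ≤ M, MultP 2 n κ (run 2 n κ c₀ i t m)) (hM : 1 ≤ M) :
    2 * M + 2 ≤ mu 2 n κ c₀ := by
  obtain ⟨hI, he, hμ⟩ := hypersurface_regime_run c₀ i t hI₀ he₀ hrun M le_rfl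
  obtain ⟨hI1, he1, hμ1⟩ := hypersurface_regime_run c₀ i t hI₀ he₀ hrun (M - 1) (by omega)
  have hs : run 2 n κ c₀ i t M = step 2 n κ (i (M - 1)) (t (M - 1)) (run 2 n κ c₀ i t (M - 1)) := by
    obtain ⟨k, rfl⟩ : ∃ k, M = k + 1 := ⟨M - 1, by omega⟩
    rfl
  have h4 := hypersurface_four_le_mu_of_double_successor (run 2 n κ c₀ i t (M - 1)) (i (M - 1))
    (t (M - 1)) (hrun (M - 1) (by omega)) hI1 (by rw [he1]; exact he₀) (hs ▸ hrun M le_rfl)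
  omega

/-- [OURS · L1 W4.6 rung (ii) at `p = 2`, every dimension; NOT a statement of the manuscript]
**A SMOOTH POINT WITHIN `μ/2` BLOW-UPS, along every branch** (`n ≥ 2`, any field of characteristic
`2`): from an isolated double state `c₀` with `e(c₀) ≤ 1`, along any chart word and translation word
there is an index `m ≤ (μ(c₀) + 1)/2` (`= μ(c₀)/2` when `e = 1`, `μ` being even; `= 1` when `e = 0`,
`μ = 1`) at which the state is NOT a double point, all earlier states `k < m` being isolated double points
of the regime with `e(c_k) = e(c₀)` and `μ(c_k) + 2k = μ(c₀)`; and that state has a LINEAR cleaned monomial — the transform `z² + ℓ(u) + …` is SMOOTH there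
(it is not the zero state: `e + 2 ≤ n` by parity, so a hyperbolic pair is present, and then a pair away
from the chart survives or a linear term appears, `ser_step_ne_zero_of_ordP`). (`n = 3`: gen 2's
`threefold_smooth_le_half`.) [folklore] -/
theorem hypersurface_smooth_le_half [CharP κ 2] (hn : 2 ≤ n) (c₀ : (Fin n → ℕ) → κ) (i : ℕ → Fin n)
    (t : ℕ → Fin n → κ) (hM₀ : MultP 2 n κ c₀) (hI₀ : Isol 2 n κ c₀) (he₀ : milnorEmbDim 2 n κ c₀ ≤ 1) :
    ∃ m, 2 * m ≤ mu 2 n κ c₀ + 1 ∧ ¬ MultP 2 n κ (run 2 n κ c₀ i t m) ∧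
      (∀ k < m, MultP 2 n κ (run 2 n κ c₀ i t k) ∧ Isol 2 n κ (run 2 n κ c₀ i t k) ∧
        milnorEmbDim 2 n κ (run 2 n κ c₀ i t k) = milnorEmbDim 2 n κ c₀ ∧
        mu 2 n κ (run 2 n κ c₀ i t k) + 2 * k = mu 2 n κ c₀) ∧
      ∃ A, clean 2 n κ (run 2 n κ c₀ i t m) A ≠ 0 ∧ Finset.sum Finset.univ (fun j => A j) = 1 := by
  classical
  -- the first exit index exists: not all states up to `μ/2` are double points
  have hex : ∃ m, m ≤ mu 2 n κ c₀ / 2 + 1 ∧ ¬ MultP 2 n κ (run 2 n κ c₀ i t m) := by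
    by_contra h
    push Not at h
    have := hypersurface_two_mul_add_two_le_mu c₀ i t hI₀ he₀ (M := mu 2 n κ c₀ / 2 + 1)
      (fun m hm => h m hm) (by omega)
    omega
  obtain ⟨m₀, -, hm₀⟩ := hex
  have hex' : ∃ m, ¬ MultP 2 n κ (run 2 n κ c₀ i t m) := ⟨m₀, hm₀⟩
  -- take the least exit index
  let m := Nat.find hex'
  have hm : ¬ MultP 2 n κ (run 2 n κ c₀ i t m) := Nat.find_spec hex'
  have hbefore : ∀ k < m, MultP 2 n κ (run 2 n κ c₀ i t k) := fun k hk => by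
    have := Nat.find_min hex' hk
    push Not at this
    exact this
  have hm1 : 1 ≤ m := by
    by_contra h0
    have : m = 0 := by omega
    rw [this] at hm
    exact hm hM₀
  have hreg := hypersurface_regime_run c₀ i t hI₀ he₀ (M := m - 1)
    (fun k hk => hbefore k (by omega))
  refine ⟨m, ?_, hm, fun k hk => ⟨hbefore k hk, hreg k (by omega)⟩, ?_⟩
  · -- `2m ≤ μ + 1`: `m = 1` from `μ ≥ 1`, or the run bound at `M = m - 1`
    rcases Nat.lt_or_ge 1 m with h2 | h1
    · have := hypersurface_two_mul_add_two_le_mu c₀ i t hI₀ he₀ (M := m - 1)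
        (fun k hk => hbefore k (by omega)) (by omega)
      omega
    · have hpos := mu_pos (p := 2) le_rfl hI₀ hM₀
      omega
  · -- the exit state is not zero (a pair away from the chart survives or a linear term appears)
    have hO : OrdP 2 n κ (run 2 n κ c₀ i t (m - 1)) := by
      rw [ordP_iff_milnorEmbDim_add_two_le (hbefore (m - 1) (by omega)), (hreg (m - 1) le_rfl).2.1]
      have hpar := (milnorEmbDim_le_and_mod_two hM₀).2.1
      omega
    have hs : run 2 n κ c₀ i t m = step 2 n κ (i (m - 1)) (t (m - 1)) (run 2 n κ c₀ i t (m - 1)) := by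
      obtain ⟨k, hk⟩ : ∃ k, m = k + 1 := ⟨m - 1, by omega⟩
      rw [hk]
      rfl
    rw [hs] at hm ⊢
    exact exists_linear_of_not_multP
      (ser_step_ne_zero_of_ordP _ _ _ (hbefore (m - 1) (by omega)) hO) hm

end Dynamics

end CampaignW46.HypersurfacesCharTwo

end Summit.ResolutionOfSingularities.ResolutionOfSingularities.Theorems

end
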